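import Summits.QuantumFields.Balaban3D.Proofs.FibreZeroSU2

/-!
# `Summit.QuantumFields.Balaban3D.Proofs.FibreZeroSU2Regular` — THE REGULARITY ROW OF `…FibreZeroSU2.fibre_pair_zero_of_pins` DISCHARGED FROM
# THE MINIMIZER'S REGULARITY: if the background `U₁(V)` has small plaquettes, the fluctuation integrand `Ψ_V` of [Balaban1985UV3] (22) is
# positive on a neighbourhood of `A′ = 0`, hence `∫ Ψ_V dμ_V > 0`; so PRINT'S DATA + the b11 row «`χ₁(V) = 1 ⇒ |U₁(V)(∂p) − 1| < ε₁(0)`» give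
# BOTH residuals R3D-01(triv) / R3D-02 at `k = 0`, `G = SU(2)` (seat p4, lane `pub-balaban3d`; closes step (S4) of HOME/drafts/p4/FIBRE49.md)

HONEST FRAMING (lane PLAN.md §0, binding): see `…Proofs.SectAFirstStep`.  [folklore] point-set topology and measure theory in the chart
(`A′ ↦ U(V, A′) = U′(g₀A′)·U₁(V)` is continuous, the small-field set is open, Lebesgue charges open sets, `Ψ_V e^{−q_V}` is bounded with bounded
support); nothing of the paper is asserted — the regularity of the minimizer ([7] Thm 1, binder b11) stays the HYPOTHESIS `hmin`.
-/

noncomputable section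

namespace Summit.QuantumFields.Balaban3D.Proofs.FibreZeroSU2Regular

open _root_.MeasureTheory Metric
open Literature.MathematicalPhysics.QuantumFieldTheory.Balaban1983to89
open Literature.MathematicalPhysics.QuantumFieldTheory.Balaban1983to89.AveragingRT (axialAvg)
open Literature.MathematicalPhysics.QuantumFieldTheory.Balaban1983to89.T4HaarSU2ExpChart (expPoint expWeight continuous_expPoint expPoint_zero
  expWeight_pos expWeight_le expWeight_nonneg measurable_expWeight)
open Literature.MathematicalPhysics.QuantumFieldTheory.Balaban1983to89.B10SectAGathering (StepPieces)
open Literature.MathematicalPhysics.QuantumFieldTheory.Balaban1985CMP102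
open Literature.MathematicalPhysics.QuantumFieldTheory.Balaban1985CMP102.Setting
open Summit.QuantumFields.Balaban3D.Carriers
open Summit.QuantumFields.Balaban3D.Proofs.Bound55Std
open Summit.QuantumFields.Balaban3D.Proofs.ProductChartSU2 (SU2)
open Summit.QuantumFields.Balaban3D.Proofs.AxialGauge (crossBond)
open Summit.QuantumFields.Balaban3D.Proofs.AxialGaugeFix (forest axGlue_of_mem_forest axGlue_cross axGlue_free)
open Summit.QuantumFields.Balaban3D.Proofs.AxialGaugeShift (fluct)
open Summit.QuantumFields.Balaban3D.Proofs.FluctChartSU2 (IsDummy fluctFree)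
open Summit.QuantumFields.Balaban3D.Proofs.FluctGaussSU2
open Summit.QuantumFields.Balaban3D.Proofs.ChartScalingSU2 (E3)
open Summit.QuantumFields.Balaban3D.Proofs.GaussianNormalization (partZ normalized)
open Literature.MathematicalPhysics.QuantumLattice (continuous_fundamentalRep)
open Summit.QuantumFields.Balaban3D.Proofs.FibreZeroSU2

variable {P : Params} {j : ℕ} [DecidableEq (PBond P j)]

/-! ## §1 The field in the chart is a continuous function of the chart variables -/

section Chart

variable {G : Type*} [GaugeGroup G] [MeasurableSpace G] [HaarData G]

omit [HaarData G] in
/-- The fluctuation field of the free variables, bondwise: `1` on the dummy bonds, the free variable elsewhere. [folklore] -/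
theorem fluctFree_apply (hj : j + 1 ≤ P.m + P.K) (w : {b : PBond P j // ¬ IsDummy b} → G) (b : PBond P j) :
    fluctFree w b = if h : IsDummy b then (1 : G) else w ⟨b, h⟩ := by
  unfold fluctFree fluct
  by_cases hT : b ∈ forest P j
  · rw [axGlue_of_mem_forest hj _ _ hT, dif_pos (show IsDummy b from Or.inl hT)]
  · by_cases hX : ∃ c : PBond P (j + 1), crossBond c = b
    · have hd : IsDummy b := Or.inr hX
      obtain ⟨c, rfl⟩ := hX
      rw [axGlue_cross hj, dif_pos hd]; rfl
    · have hX' : ∀ c, b ≠ crossBond c := fun c hc => hX ⟨c, hc.symm⟩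
      have hnd : ¬ IsDummy b := fun hd => hd.elim hT hX
      rw [axGlue_free _ _ hT hX', dif_neg hnd]
      show (if h : ¬ IsDummy b then w ⟨b, h⟩ else (1 : G)) = w ⟨b, hnd⟩
      rw [dif_pos hnd]

end Chart

/-- `A′ ↦ U(V, A′)(b)` is continuous for every bond (`exp` is continuous; dummy bonds carry the constant `U₁(V)(b)`). [folklore] -/
theorem continuous_fieldAt_apply (hj : j + 1 ≤ P.m + P.K) (U₁ : GaugeField P (j + 1) SU2 → GaugeField P j SU2) (g₀ : ℝ)
    (V : GaugeField P (j + 1) SU2) (b : PBond P j) :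
    Continuous fun A : {b : PBond P j // ¬ IsDummy b} → E3 => fieldAt U₁ g₀ V A b := by
  unfold fieldAt
  refine Continuous.mul ?_ continuous_const
  by_cases h : IsDummy b
  · simp only [fluctFree_apply hj, dif_pos h]; exact continuous_const
  · simp only [fluctFree_apply hj, dif_neg h]
    exact continuous_expPoint.comp ((continuous_apply _).comp (continuous_const_smul g₀))

/-- `A′ ↦ U(V, A′)(∂p)` is continuous for every plaquette. [folklore] -/
theorem continuous_plaqHol_fieldAt (hj : j + 1 ≤ P.m + P.K) (U₁ : GaugeField P (j + 1) SU2 → GaugeField P j SU2) (g₀ : ℝ)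
    (V : GaugeField P (j + 1) SU2) (p : Plaq P j) :
    Continuous fun A : {b : PBond P j // ¬ IsDummy b} → E3 => GaugeField.plaqHol (fieldAt U₁ g₀ V A) p := by
  show Continuous fun A : {b : PBond P j // ¬ IsDummy b} → E3 =>
    fieldAt U₁ g₀ V A ⟨p.src, p.μ⟩ * fieldAt U₁ g₀ V A ⟨p.src.shift p.μ, p.ν⟩ * (fieldAt U₁ g₀ V A ⟨p.src.shift p.ν, p.μ⟩)⁻¹ *
      (fieldAt U₁ g₀ V A ⟨p.src, p.ν⟩)⁻¹
  have h1 := continuous_fieldAt_apply hj U₁ g₀ V ⟨p.src, p.μ⟩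
  have h2 := continuous_fieldAt_apply hj U₁ g₀ V ⟨p.src.shift p.μ, p.ν⟩
  have h3 := (continuous_fieldAt_apply hj U₁ g₀ V ⟨p.src.shift p.ν, p.μ⟩).inv
  have h4 := (continuous_fieldAt_apply hj U₁ g₀ V ⟨p.src, p.ν⟩).inv
  exact ((h1.mul h2).mul h3).mul h4

/-- `A′ ↦ U(V, A′)` is measurable (coordinatewise continuous). [folklore] -/
theorem measurable_fieldAt (hj : j + 1 ≤ P.m + P.K) (U₁ : GaugeField P (j + 1) SU2 → GaugeField P j SU2) (g₀ : ℝ)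
    (V : GaugeField P (j + 1) SU2) : Measurable (fieldAt U₁ g₀ V : ({b : PBond P j // ¬ IsDummy b} → E3) → GaugeField P j SU2) :=
  measurable_pi_iff.mpr fun b => (continuous_fieldAt_apply hj U₁ g₀ V b).measurable

/-- At the origin of the chart the field IS the background: `U(V, 0) = U₁(V)`. [folklore] -/
theorem fieldAt_zero (hj : j + 1 ≤ P.m + P.K) (U₁ : GaugeField P (j + 1) SU2 → GaugeField P j SU2) (g₀ : ℝ)
    (V : GaugeField P (j + 1) SU2) : fieldAt U₁ g₀ V 0 = U₁ V := by
  funext b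
  unfold fieldAt
  rw [fluctFree_apply hj]
  by_cases h : IsDummy b
  · rw [dif_pos h, one_mul]
  · rw [dif_neg h, smul_zero, Pi.zero_apply, expPoint_zero, one_mul]

/-- **THE SMALL-FIELD SET IN THE CHART IS OPEN**: `{A′ : ‖g₀A′_b‖ < π ∀b, |U(V,A′)(∂p) − 1| < ε ∀p}`. [folklore] -/
theorem isOpen_smallSet (hj : j + 1 ≤ P.m + P.K) (U₁ : GaugeField P (j + 1) SU2 → GaugeField P j SU2) (g₀ ε : ℝ)
    (V : GaugeField P (j + 1) SU2) :
    IsOpen {A : {b : PBond P j // ¬ IsDummy b} → E3 |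
      (g₀ • A ∈ Set.univ.pi fun _ => ball (0 : E3) Real.pi) ∧ PlaqSmall ε (fieldAt U₁ g₀ V A)} := by
  rw [Set.setOf_and]
  refine IsOpen.inter ?_ ?_
  · show IsOpen ((fun A : {b : PBond P j // ¬ IsDummy b} → E3 => g₀ • A) ⁻¹' Set.univ.pi fun _ => ball (0 : E3) Real.pi)
    exact (isOpen_set_pi Set.finite_univ fun _ _ => isOpen_ball).preimage (continuous_const_smul g₀)
  · have : {A : {b : PBond P j // ¬ IsDummy b} → E3 | PlaqSmall ε (fieldAt U₁ g₀ V A)} =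
        ⋂ p : Plaq P j, {A | dist1 (GaugeField.plaqHol (fieldAt U₁ g₀ V A) p) < ε} := by
      ext A; simp only [PlaqSmall, Set.mem_setOf_eq, Set.mem_iInter]
    rw [this]
    have hcont : Continuous (dist1 : SU2 → ℝ) := UnitaryModel.continuous_opDist1.comp (continuous_fundamentalRep (Fin 2))
    exact isOpen_iInter_of_finite fun p =>
      isOpen_lt (hcont.comp (continuous_plaqHol_fieldAt hj U₁ g₀ V p)) continuous_const

/-! ## §2 Positivity of the fluctuation integral -/

/-- `σ(x)/σ₀ ≤ 1`. [folklore] -/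
theorem expWeight_div_sigma0_le_one (x : E3) : expWeight x / sigma0 ≤ 1 := by
  rw [div_le_one sigma0_pos]
  refine (expWeight_le x).trans (le_of_eq ?_)
  show (2 * Real.pi ^ 2)⁻¹ = expWeight 0
  unfold T4HaarSU2ExpChart.expWeight
  simp [Real.sinc_zero]

/-- **`∫ Ψ_V dμ_V > 0` WHEN THE BACKGROUND HAS SMALL PLAQUETTES.**  For `S ≥ 0` measurable (print: `(1/g₀²)A`), the small-field function `χ = χ_ε`
of (4), `g₀ > 0`, a measurable quadratic datum `q_V` with `Z(V) > 0`, and a background with `|U₁(V)(∂p) − 1| < ε` for all `p`: the fluctuation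
integrand is `> 0` on an open neighbourhood of `A′ = 0` (continuity of the chart, `U(V,0) = U₁(V)`), it is `μ_V`-integrable (`Ψ_V e^{−q_V}` is bounded by
`e^{S(U₁V)}` and vanishes off the bounded chart box), and `μ_V` charges open sets. [folklore] -/
theorem fluctIntegral_pos (hj : j + 1 ≤ P.m + P.K) (S : GaugeField P j SU2 → ℝ) (hSm : Measurable S) (hS0 : ∀ U, 0 ≤ S U) (ε : ℝ)
    (q : GaugeField P (j + 1) SU2 → ({b : PBond P j // ¬ IsDummy b} → E3) → ℝ)
    (U₁ : GaugeField P (j + 1) SU2 → GaugeField P j SU2) {g₀ : ℝ} (hg : 0 < g₀) (V : GaugeField P (j + 1) SU2)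
    (hqm : Measurable (q V)) (hZ : 0 < partZ (volume : Measure ({b : PBond P j // ¬ IsDummy b} → E3)) (q V))
    (hmin : PlaqSmall ε (U₁ V)) :
    0 < ∫ A, fluctIntegrand S (chiSmall Set.univ ε) q U₁ g₀ V A
      ∂(normalized (volume : Measure ({b : PBond P j // ¬ IsDummy b} → E3)) (q V)) := by
  classical
  set Ψ : (Free P j → E3) → ℝ := fluctIntegrand S (chiSmall Set.univ ε) q U₁ g₀ V with hΨ
  -- (i) the open neighbourhood of 0 on which Ψ > 0
  have hOopen := isOpen_smallSet hj U₁ g₀ ε V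
  have h0O : (0 : Free P j → E3) ∈ {A : Free P j → E3 |
      (g₀ • A ∈ Set.univ.pi fun _ => ball (0 : E3) Real.pi) ∧ PlaqSmall ε (fieldAt U₁ g₀ V A)} := by
    refine ⟨?_, ?_⟩
    · rw [smul_zero]; exact fun i _ => by simpa using Real.pi_pos
    · rw [fieldAt_zero hj]; exact hmin
  have hχ01 : ∀ U : GaugeField P j SU2, 0 ≤ chiSmall Set.univ ε U ∧ chiSmall Set.univ ε U ≤ 1 := fun U => by
    unfold chiSmall; split_ifs <;> norm_num
  have hΨpos : ∀ A ∈ {A : Free P j → E3 |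
      (g₀ • A ∈ Set.univ.pi fun _ => ball (0 : E3) Real.pi) ∧ PlaqSmall ε (fieldAt U₁ g₀ V A)}, 0 < Ψ A := by
    rintro A ⟨hA, hsm⟩
    have hχ : chiSmall Set.univ ε (fieldAt U₁ g₀ V A) = 1 := by
      unfold chiSmall; rw [if_pos (show PlaqSmallOn Set.univ ε (fieldAt U₁ g₀ V A) from fun p _ => hsm p)]
    rw [hΨ]; unfold fluctIntegrand
    rw [Set.indicator_of_mem hA, hχ, one_mul, one_mul]
    exact mul_pos (Finset.prod_pos fun i _ => div_pos (expWeight_pos (hA i (Set.mem_univ _))) sigma0_pos) (Real.exp_pos _)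
  have hΨnn : ∀ A, 0 ≤ Ψ A := fun A => fluctIntegrand_nonneg S _ (fun U => (hχ01 U).1) q U₁ g₀ V A
  -- (ii) measurability
  have hfm := measurable_fieldAt hj U₁ g₀ V
  have hqneg : Measurable fun A : Free P j → E3 => -(q V A) := hqm.neg
  have hexpq : Measurable fun A : Free P j → E3 => Real.exp (-(q V A)) := Real.measurable_exp.comp hqneg
  have hΨm : Measurable Ψ := by
    rw [hΨ]; unfold fluctIntegrand
    refine ((((measurable_const.indicator (MeasurableSet.univ_pi fun _ => measurableSet_ball)).comp
      (measurable_const_smul g₀)).mul ((T4AxialGaugeFixing.measurable_chiSmall _ _).comp hfm)).mul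
      (Finset.measurable_prod _ fun i _ => ((measurable_expWeight.comp
        ((measurable_pi_apply i).comp (measurable_const_smul g₀))).div_const _))).mul
      (Real.measurable_exp.comp ((((hSm.comp hfm).sub measurable_const).neg).add hqm))
  -- (iii) `Ψ e^{−q}` is bounded by `e^{S(U₁ V)}` on the bounded chart box and vanishes off it
  have hKm : MeasurableSet {A : Free P j → E3 | g₀ • A ∈ Set.univ.pi fun _ => ball (0 : E3) Real.pi} :=
    (MeasurableSet.univ_pi fun _ => measurableSet_ball).preimage (measurable_const_smul g₀)
  have hKbdd : {A : Free P j → E3 | g₀ • A ∈ Set.univ.pi fun _ => ball (0 : E3) Real.pi} ⊆ ball 0 (Real.pi / g₀) := fun A hA => by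
    rw [mem_ball_zero_iff, pi_norm_lt_iff (div_pos Real.pi_pos hg)]
    intro i
    have hi : ‖(g₀ • A) i‖ < Real.pi := mem_ball_zero_iff.mp (hA i (Set.mem_univ _))
    rw [Pi.smul_apply, norm_smul, Real.norm_eq_abs, abs_of_pos hg] at hi
    rw [lt_div_iff₀ hg, mul_comm]; exact hi
  have hKfin : (volume : Measure (Free P j → E3)) {A : Free P j → E3 | g₀ • A ∈ Set.univ.pi fun _ => ball (0 : E3) Real.pi} ≠ ⊤ :=
    ((measure_mono hKbdd).trans_lt measure_ball_lt_top).ne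
  have hbound : ∀ A, ‖Real.exp (-(q V A)) • Ψ A‖ ≤
      {A : Free P j → E3 | g₀ • A ∈ Set.univ.pi fun _ => ball (0 : E3) Real.pi}.indicator (fun _ => Real.exp (S (U₁ V))) A := fun A => by
    by_cases hA : g₀ • A ∈ Set.univ.pi fun _ : Free P j => ball (0 : E3) Real.pi
    · rw [Set.indicator_of_mem (show A ∈ {A : Free P j → E3 | g₀ • A ∈ Set.univ.pi fun _ => ball (0 : E3) Real.pi} from hA),
        Real.norm_eq_abs, smul_eq_mul, abs_of_nonneg (mul_nonneg (Real.exp_pos _).le (hΨnn A)), hΨ]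
      unfold fluctIntegrand
      rw [Set.indicator_of_mem hA]
      have h1 : chiSmall Set.univ ε (fieldAt U₁ g₀ V A) * ∏ i, expWeight ((g₀ • A) i) / sigma0 ≤ 1 :=
        mul_le_one₀ (hχ01 _).2 (Finset.prod_nonneg fun i _ => div_nonneg (expWeight_nonneg _) sigma0_pos.le)
          (Finset.prod_le_one (fun i _ => div_nonneg (expWeight_nonneg _) sigma0_pos.le) fun i _ => expWeight_div_sigma0_le_one _)
      have h2 : Real.exp (-(q V A)) * Real.exp (-(S (fieldAt U₁ g₀ V A) - S (U₁ V)) + q V A) ≤ Real.exp (S (U₁ V)) := by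
        rw [← Real.exp_add, Real.exp_le_exp]; have := hS0 (fieldAt U₁ g₀ V A); linarith
      calc Real.exp (-(q V A)) * ((1 : ℝ) * chiSmall Set.univ ε (fieldAt U₁ g₀ V A) * (∏ i, expWeight ((g₀ • A) i) / sigma0) *
              Real.exp (-(S (fieldAt U₁ g₀ V A) - S (U₁ V)) + q V A))
          = (chiSmall Set.univ ε (fieldAt U₁ g₀ V A) * ∏ i, expWeight ((g₀ • A) i) / sigma0) *
              (Real.exp (-(q V A)) * Real.exp (-(S (fieldAt U₁ g₀ V A) - S (U₁ V)) + q V A)) := by ring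
        _ ≤ 1 * Real.exp (S (U₁ V)) :=
          mul_le_mul h1 h2 (mul_nonneg (Real.exp_pos _).le (Real.exp_pos _).le) zero_le_one
        _ = Real.exp (S (U₁ V)) := one_mul _
    · rw [Set.indicator_of_notMem (show A ∉ {A : Free P j → E3 | g₀ • A ∈ Set.univ.pi fun _ => ball (0 : E3) Real.pi} from hA), hΨ]
      unfold fluctIntegrand
      rw [Set.indicator_of_notMem hA]
      simp
  have hint_vol : Integrable (fun A => Real.exp (-(q V A)) • Ψ A) (volume : Measure (Free P j → E3)) :=
    Integrable.mono' ((integrable_indicator_iff hKm).mpr (integrableOn_const hKfin)) (hexpq.smul hΨm).aestronglyMeasurable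
      (Filter.Eventually.of_forall hbound)
  -- (iv) integrability w.r.t. `μ_V` and the measure of the neighbourhood
  have hdm : Measurable fun A : Free P j → E3 => ENNReal.ofReal (Real.exp (-(q V A))) := ENNReal.measurable_ofReal.comp hexpq
  have hint_wd : Integrable Ψ ((volume : Measure (Free P j → E3)).withDensity fun A => ENNReal.ofReal (Real.exp (-(q V A)))) := by
    refine (integrable_withDensity_iff_integrable_smul' hdm (Filter.Eventually.of_forall fun _ => ENNReal.ofReal_lt_top)).mpr ?_
    refine hint_vol.congr (Filter.Eventually.of_forall fun A => ?_)
    simp only [ENNReal.toReal_ofReal (Real.exp_pos _).le]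
  have hc : (ENNReal.ofReal (partZ (volume : Measure (Free P j → E3)) (q V)))⁻¹ ≠ ⊤ :=
    ENNReal.inv_ne_top.mpr (ENNReal.ofReal_pos.mpr hZ).ne'
  have hintμ : Integrable Ψ (normalized (volume : Measure (Free P j → E3)) (q V)) := by
    unfold GaussianNormalization.normalized
    exact hint_wd.smul_measure hc
  have hμO : 0 < normalized (volume : Measure (Free P j → E3)) (q V) {A : Free P j → E3 |
      (g₀ • A ∈ Set.univ.pi fun _ => ball (0 : E3) Real.pi) ∧ PlaqSmall ε (fieldAt U₁ g₀ V A)} := by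
    unfold GaussianNormalization.normalized
    rw [Measure.smul_apply, smul_eq_mul]
    refine ENNReal.mul_pos (ENNReal.inv_ne_zero.mpr ENNReal.ofReal_ne_top) ?_
    intro h0
    rw [withDensity_apply_eq_zero' hdm.aemeasurable] at h0
    have hsupp : {A : Free P j → E3 | ENNReal.ofReal (Real.exp (-(q V A))) ≠ 0} ∩ {A : Free P j → E3 |
        (g₀ • A ∈ Set.univ.pi fun _ => ball (0 : E3) Real.pi) ∧ PlaqSmall ε (fieldAt U₁ g₀ V A)} = {A : Free P j → E3 |
        (g₀ • A ∈ Set.univ.pi fun _ => ball (0 : E3) Real.pi) ∧ PlaqSmall ε (fieldAt U₁ g₀ V A)} := by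
      refine Set.inter_eq_right.mpr fun A _ => ?_
      simp only [Set.mem_setOf_eq, ne_eq, ENNReal.ofReal_eq_zero, not_le]
      exact Real.exp_pos _
    rw [hsupp] at h0
    exact (hOopen.measure_pos volume ⟨0, h0O⟩).ne' h0
  -- (v) conclusion
  have key := (integral_pos_iff_support_of_nonneg_ae (Filter.Eventually.of_forall hΨnn) hintμ).mpr
    (hμO.trans_le (measure_mono fun A hA => (hΨpos A hA).ne'))
  simpa only [hΨ] using key

/-! ## §3 The lane: both residuals at the first step from print's data and the minimizer's regularity -/

section Lane

variable {L : ℕ} {S : Scales L} {Val : Type} [NormedAddCommGroup Val] [NormedSpace ℂ Val] [DecidableEq (PBond S.P 0)]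
  (X : ExternalInputs S SU2) (K : CarrierConsts) (𝔖 : ∀ k, StepSeries S SU2 Val (nblkOf S K k) k) (slot : ℕ → Prop)

/-- **R3D-01(triv) AND R3D-02 AT `k = 0`, `G = SU(2)`, FROM PRINT'S DATA AND THE b11 REGULARITY ROW.**  Standing range; the lane's axial averaging at
level 0; the background `U₁ = X.Uk 0` in the axial gauge with `Ū₁ = V` ((12) p. 258) AND REGULAR in print's sense — small coarse plaquettes force small
minimizer plaquettes at the previous threshold (`hmin`: `|V(∂p′) − 1| < ε₁(1) ∀p′ ⇒ |U₁(V)(∂p) − 1| < ε₁(0) ∀p`, [7] Thm 1 / p. 265 L24–26 «χ₁ denotes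
restrictions on V of the form |U₁(∂p) − 1| < L⁻²g₀p(g₁), where U₁ = U₁(V) is the minimal configuration determined by V», binder b11); a measurable
quadratic datum `q_V` with `Z(V) > 0` (b9); and step pieces carrying print's values at the trivial history.  THEN `Fibre49 X K 𝔖 slot 0 P triv` and
`Fibre57Low X K 𝔖 slot 0 P`. [cite: Balaban1985UV3, (12)–(22) pp.258–261 + p.265 L21–28] -/
theorem fibre_pair_zero (hj : 1 ≤ S.P.m + S.P.K) (P : StepPieces ((stdTowerInput X K 𝔖).towerWith slot).toTowerRun 0)
    (hav : (X.av 0).avg = axialAvg) (hax : ∀ V, ∀ b ∈ forest S.P 0, X.Uk 0 V b = 1) (hfib : ∀ V, axialAvg (X.Uk 0 V) = V)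
    (hmin : ∀ V, PlaqSmall (eps1Of S K 1) V → PlaqSmall (eps1Of S K 0) (X.Uk 0 V))
    (q : GaugeField S.P 1 SU2 → (Free S.P 0 → E3) → ℝ) (hqm : ∀ V, Measurable (q V))
    (hZ : ∀ V, 0 < partZ (volume : Measure (Free S.P 0 → E3)) (q V))
    (hσ : P.logσ₀ = Real.log sigma0) (hdg : P.dg = 3) (hstar : P.starB (Hist.triv S.P 1) = Fintype.card (Free S.P 0))
    (hPold : ∀ V, P.Pold (Hist.triv S.P 1) V = 0)
    (hZU : ∀ V, P.logZU (Hist.triv S.P 1) V = Real.log (partZ (volume : Measure (Free S.P 0 → E3)) (q V)))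
    (hFl : ∀ V, P.logFl (Hist.triv S.P 1) V =
      Real.log (∫ A, fluctIntegrand (act0 S) (chiSmall Set.univ (eps1Of S K 0)) q (X.Uk 0) (S.gk 0) V A
        ∂(normalized (volume : Measure (Free S.P 0 → E3)) (q V)))) :
    Fibre49 X K 𝔖 slot 0 P (Hist.triv S.P 1) ∧ Fibre57Low X K 𝔖 slot 0 P := by
  have hg : 0 < S.gk 0 := B10.gRun_pos _ _ _ S.g_pos (by have := S.hL.2; exact_mod_cast (by omega : 0 < L)) S.ε_pos 0
  exact fibre_pair_zero_of_pins X K 𝔖 slot hj P hav hax hfib q hqm hZ hσ hdg hstar hPold hZU hFl fun V hV =>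
    fluctIntegral_pos hj (act0 S) measurable_act0 act0_nonneg (eps1Of S K 0) q (X.Uk 0) hg V (hqm V) (hZ V) (hmin V hV)

end Lane

end Summit.QuantumFields.Balaban3D.Proofs.FibreZeroSU2Regular

end
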